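import Mathlib
import HarnessLib
import Summits.Langlands.Langlands.Theses.GSpinCensusRung

/-!
# Birth skeleton (BC3) for crux stmt-Langlands-11944
`Summit.Langlands.Langlands.Theses.GSpinCensusRung.MoretBaillySeed` — line `birth`

Route `route-Langlands-GSpinCensusRung` (rank-3 crux, "THE MORET-BAILLY STEP", card S3). The crux asks, for
`ρ : Γ_F → GL_6(ℚ̄_p)` in the ordinary rank-6 symplectic province of Hodge type (1,2,2,1) over a totally real
`F` (p > 13 split completely, Greenberg-ordinary of shape (0,1,1,2,2,3) and residually distinguished at
`v ∣ p`, `ρ̄|Γ_{F(ζ_p)}` absolutely irreducible), for a finite Galois totally real `F'/F` keeping `p` split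
and both irreducibility clauses, together with a SEED over `F'`: `ρ₀` a.e. unramified, Greenberg-ordinary of
the same shape at `w ∣ p`, residually congruent to `ρ|F'` and WEAKLY AUTOMORPHIC of Hodge type
(3; 0,1,1,2,2,3) for the given `ι : ℚ̄_p ≃ ℂ`.

The skeleton is the Harris–Shepherd-Barron–Taylor / BLGGT architecture of every printed potential-automorphy
theorem (doi:10.4007/annals.2010.171.779 §3; BarnetlambEtAl2014 §3–4), cut at its three joints and re-typed
over the accepted API in the province's (non-regular) weight:

* `stub_moretBaillyPair` — **the geometric step (Moret-Bailly on a (1,2,2,1) family, second prime).**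
  From `ρ` one gets `F'/F` finite Galois totally real (p split completely, `ρ|F'` irreducible,
  `ρ̄|Γ_{F'(ζ_p)}` absolutely irreducible — the avoidance clauses), a `p`-adic `ρ₀` over `F'` (a.e.
  unramified, Greenberg-ordinary of shape (0,1,1,2,2,3) at `w ∣ p`, residually congruent to `ρ|F'`), a SECOND
  prime `q` with `ι_q : ℚ̄_q ≃ ℂ` and a `q`-adic `ρ₁` over `F'` which is `ι`-COMPATIBLE with `ρ₀` at almost
  all places (Frobenius characteristic polynomials agree in `ℂ[X]` through `ι`, `ι_q`) and satisfies, at `q`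
  over `F'`, the whole antecedent of the route's lifting theorem: `q > 13` split completely in `F'`, `ρ₁`
  irreducible, a.e. unramified, odd, `GSp_6`-valued, Greenberg-ordinary and residually distinguished at
  `w ∣ q`, `ρ̄₁|Γ_{F'(ζ_q)}` absolutely irreducible, with a weakly automorphic Greenberg-ordinary `q`-adic
  seed `ρ₂ ≡ ρ₁ (mod 𝔪)`. Intended witness: `ρ₀ ⊕ ρ₁ = H³` (p- and q-adic) of a fibre `X_t`, `t ∈ T(F')`,
  of a big-monodromy family with Hodge vector (1,2,2,1), found by Moret-Bailly (Moretbailly1989) with local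
  conditions at `p` (ordinary fibre, `X_t[p] ≅ ρ̄`), at `q` (`X_t[q] ≅ Ind θ̄` for an algebraic Hecke
  character `θ` of a CM field, `ρ₂ = Ind θ` automorphic by Arthur–Clozel induction) and at `∞`; `q ≠ p`
  is intended but not demanded (the statement is an `∃`). Size XL; carries the crux's recorded obstruction
  (the `ℚ_p`-fibre must realise `ρ̄|Γ_{F_v}` with `p` split completely).
* `stub_fibreLifting` — **ordinary automorphy lifting in the singular weight at the second prime** (the
  route's rank-2 crux `SingularWeightLifting` in its PLAIN form `F = F'`, applied to `ρ₁` at `q`): the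
  antecedent above ⟹ `ρ₁` is weakly automorphic of Hodge type (3; 0,1,1,2,2,3) for `ι_q`. Size: open
  problem (higher Hida theory on the GSpin(2,5) fivefold; BoxerEtAl2021 one node over).
* `stub_compatibleTransfer` — **weak automorphy is a property of the compatible pair**: if `(ρ₀, ι_p)` and
  `(ρ₁, ι_q)` have `ι`-matching Frobenius characteristic polynomials at almost all places, `ρ₀` is a.e.
  unramified, and `π` is Satake–Frobenius compatible with `ρ₁` through `ι_q` almost everywhere, then `π` is
  Satake–Frobenius compatible with `ρ₀` through `ι_p` almost everywhere (`arithFrobPolyOfSatake ι q 1 α` is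
  the `ι⁻¹`-image of one complex polynomial, `arithFrobPolyOfSatake_eq_map_symm`; Frobenius char-polys at an
  unramified place are unique). Size M (Serre 1968 I §2.3; the step "one member automorphic ⟹ all members
  automorphic" of HSBT/BLGGT). Stated for every rank `n`.
* `MoretBaillySeed_of` — **the composition, kernel-checked (no `sorry`)**: PAIR, then LIFTING at `q` for
  `ρ₁` over `F'`, then TRANSFER from `(ρ₁, ι_q)` to `(ρ₀, ι)`; concludes the route decl BY NAME.

Honest reading of the cut: the two hard stubs are genuinely different mathematics (arithmetic geometry of a
(1,2,2,1) family + Moret-Bailly + automorphic induction in `stub_moretBaillyPair`; a singular-weight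
`R = T` / higher-Hida theorem in `stub_fibreLifting`), and neither gives the crux alone: the pair carries NO
automorphy at `p`, the lifting theorem speaks about `q`-adic representations only, and the transfer lemma is
the bridge. No stub mentions `Langlands`.

Disproof used: none on file for this crux (`ledger crux ls stmt-Langlands-11944`: no workfiles, no
`Disproof.lean`, no `Negative/` lemmas, 2026-08-17); `ledger negatives --problem Langlands` (3 entries:
SplitPrimeInduction deinduction, OrdinaryPrimeTransport pole count, K3 Serre-type anchor) — none concerns
seeds, Moret-Bailly or compatible pairs.

Shape (for `ledger skeleton check`): stubs `theorem stub_<name> : <signature> := by sorry` stated over tree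
declarations only; `_Goal.stub_<name> : Prop := type_of% @stub_<name>` names each statement; the composition
`MoretBaillySeed_of (hA : _Goal.stub_moretBaillyPair) (hB : _Goal.stub_fibreLifting)
(hC : _Goal.stub_compatibleTransfer) : MoretBaillySeed` is proved without `sorry`.
-/

set_option linter.dupNamespace false
set_option linter.unusedVariables false

noncomputable section

namespace Summit.Langlands.Langlands.Cruxes.MoretBaillySeed.Birth

open Summit.Langlands Summit.Langlands.Langlands.Theses.GSpinCensusRung
open Literature.NumberTheory.Automorphic Literature.NumberTheory.GaloisRepresentations
open NumberField IsDedekindDomain Filter Polynomial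

/-! ## 1. The three stubs -/

/-- **STUB 1 — the Moret-Bailly step proper: a potential `ι`-compatible pair with a liftable second member.**
For `ρ : Γ_F → GL_6(ℚ̄_p)` with the Galois-side hypotheses of the province (p > 13; irreducible, a.e.
unramified, odd, `GSp_6`-valued; Greenberg-ordinary of shape (0,1,1,2,2,3) and residually distinguished at
every `v ∣ p`; `p` split completely in `F`; `ρ̄|Γ_{F(ζ_p)}` absolutely irreducible) there are: a finite
Galois totally real `F'/F` with `p` split completely in `F'`, `ρ|F'` irreducible and `ρ̄|Γ_{F'(ζ_p)}`
absolutely irreducible; a `p`-adic `ρ₀ : Γ_{F'} → GL_6(ℚ̄_p)`, a.e. unramified, Greenberg-ordinary of shape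
(0,1,1,2,2,3) at every `w ∣ p` and residually congruent to `ρ|F'`; a prime `q`, `ι_q : ℚ̄_q ≃ ℂ` and a
`q`-adic `ρ₁ : Γ_{F'} → GL_6(ℚ̄_q)` such that (i) `ρ₀` and `ρ₁` are `ι`-compatible at almost all places
(their Frobenius characteristic polynomials have the same image in `ℂ[X]` under `ι`, `ι_q`), and (ii) `ρ₁`
satisfies at `q` over `F'` the full antecedent of the singular-weight lifting theorem: `q > 13`, `ρ₁`
irreducible, a.e. unramified, odd, `GSp_6`-valued, Greenberg-ordinary of shape (0,1,1,2,2,3) and residually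
distinguished at every `w ∣ q`, `q` split completely in `F'`, `ρ̄₁|Γ_{F'(ζ_q)}` absolutely irreducible, and a
`q`-adic seed `ρ₂` (a.e. unramified, Greenberg-ordinary at `w ∣ q`, residually congruent to `ρ₁`, weakly
automorphic of Hodge type (3; 0,1,1,2,2,3) for `ι_q`). Intended witness (HSBT §3 / BLGGT §3 in Hodge type
(1,2,2,1)): `ρ₀, ρ₁` = `p`- and `q`-adic `H³` of a fibre `X_t`, `t ∈ T(F')`, of a geometrically irreducible
family with Hodge vector (1,2,2,1) and mod-`p`, mod-`q` monodromy onto `GSp_6` (rank-6 weight-3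
hypergeometric lines, Beukers–Heckman; lines in two-parameter Calabi–Yau pencils), `t` produced by
Moret-Bailly with local conditions at `p` (close to an ordinary `ℚ_p`-fibre with `X_t[p] ≅ ρ̄|Γ_{F_v}`), at
`q` (`X_t[q] ≅ Ind θ̄`, `θ` an algebraic Hecke character of a CM extension cyclic of degree 6, infinity
type realising {0,3}∪{1,2}∪{1,2}, `q` split; `ρ₂ := Ind θ`, automorphic on `GL_6` by Arthur–Clozel
induction, re-induced over `F'`) and at `∞`; `F'` linearly disjoint from the fixed field of `ker ρ̄ · F(ζ_p)`.
Size XL. Why it might fail: the crux's own recorded obstruction lives here — with `p` split completely the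
`ℚ_p`-fibre must realise the given `ρ̄|Γ_{F_v}` (unit-root characters depend on `t mod p`), and full mod-`ℓ`
monodromy of the candidate families is only known Zariski-dense.
[cite: Moretbailly1989, Thm. 1.3] [cite: BarnetlambEtAl2014, §3] [cite: BeukersHeckman1989, Thm. 6.5]
(doi:10.4007/annals.2010.171.779, Harris–Shepherd-Barron–Taylor 2010, §3) -/
theorem stub_moretBaillyPair :
    ∀ (F : Type) [Field F] [NumberField F] [NumberField.IsTotallyReal F] (p : ℕ) [Fact p.Prime]
      (ι : PadicAlgCl p ≃+* ℂ) (ρ : FramedGaloisRep F (PadicAlgCl p) 6),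
      (13 < p ∧ ρ.toGaloisRep.IsIrreducible ∧
        (∀ᶠ v : HeightOneSpectrum (𝓞 F) in cofinite, ρ.IsUnramifiedAt v) ∧ ρ.IsOdd ∧
        FramedRep.IsGSpValued ρ ∧
        (∀ v : HeightOneSpectrum (𝓞 F), (p : 𝓞 F) ∈ v.asIdeal →
          ρ.IsGreenbergOrdinaryOfShapeAt v ![0, 1, 1, 2, 2, 3] ∧
          ρ.IsResiduallyDistinguishedAt v ![0, 1, 1, 2, 2, 3])) →
      (∀ v : HeightOneSpectrum (𝓞 F), (p : 𝓞 F) ∈ v.asIdeal →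
        Nat.card (𝓞 F ⧸ v.asIdeal) = p ∧ (p : 𝓞 F) ∉ v.asIdeal ^ 2) →
      FramedRep.HasAbsolutelyIrreducibleReduction (ρ.restrictField (CyclotomicField p F)) →
      ∃ (F' : Type) (_ : Field F') (_ : NumberField F') (_ : Algebra F F') (_ : IsGalois F F'),
        NumberField.IsTotallyReal F' ∧ (ρ.restrictField F').toGaloisRep.IsIrreducible ∧
        (∀ v : HeightOneSpectrum (𝓞 F'), (p : 𝓞 F') ∈ v.asIdeal →
          Nat.card (𝓞 F' ⧸ v.asIdeal) = p ∧ (p : 𝓞 F') ∉ v.asIdeal ^ 2) ∧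
        FramedRep.HasAbsolutelyIrreducibleReduction
          ((ρ.restrictField F').restrictField (CyclotomicField p F')) ∧
        ∃ ρ₀ : FramedGaloisRep F' (PadicAlgCl p) 6,
          (∀ᶠ v : HeightOneSpectrum (𝓞 F') in cofinite, ρ₀.IsUnramifiedAt v) ∧
          (∀ v : HeightOneSpectrum (𝓞 F'), (p : 𝓞 F') ∈ v.asIdeal →
            ρ₀.IsGreenbergOrdinaryOfShapeAt v ![0, 1, 1, 2, 2, 3]) ∧
          FramedRep.IsResiduallyCongruent (ρ.restrictField F') ρ₀ ∧
          ∃ (q : ℕ) (_ : Fact q.Prime) (ιq : PadicAlgCl q ≃+* ℂ)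
            (ρ₁ : FramedGaloisRep F' (PadicAlgCl q) 6),
            -- (i) `(ρ₀, ι)` and `(ρ₁, ι_q)` are compatible at almost all places
            (∀ᶠ v : HeightOneSpectrum (𝓞 F') in cofinite,
              ∃ (P₀ : (PadicAlgCl p)[X]) (P₁ : (PadicAlgCl q)[X]),
                ρ₀.HasFrobCharpolyAt v P₀ ∧ ρ₁.HasFrobCharpolyAt v P₁ ∧
                P₀.map (ι : PadicAlgCl p →+* ℂ) = P₁.map (ιq : PadicAlgCl q →+* ℂ)) ∧
            -- (ii) the lifting antecedent for `ρ₁` at `q` over `F'`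
            (13 < q ∧ ρ₁.toGaloisRep.IsIrreducible ∧
              (∀ᶠ v : HeightOneSpectrum (𝓞 F') in cofinite, ρ₁.IsUnramifiedAt v) ∧ ρ₁.IsOdd ∧
              FramedRep.IsGSpValued ρ₁ ∧
              (∀ v : HeightOneSpectrum (𝓞 F'), (q : 𝓞 F') ∈ v.asIdeal →
                ρ₁.IsGreenbergOrdinaryOfShapeAt v ![0, 1, 1, 2, 2, 3] ∧
                ρ₁.IsResiduallyDistinguishedAt v ![0, 1, 1, 2, 2, 3])) ∧
            (∀ v : HeightOneSpectrum (𝓞 F'), (q : 𝓞 F') ∈ v.asIdeal →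
              Nat.card (𝓞 F' ⧸ v.asIdeal) = q ∧ (q : 𝓞 F') ∉ v.asIdeal ^ 2) ∧
            FramedRep.HasAbsolutelyIrreducibleReduction (ρ₁.restrictField (CyclotomicField q F')) ∧
            (∃ ρ₂ : FramedGaloisRep F' (PadicAlgCl q) 6,
              (∀ᶠ v : HeightOneSpectrum (𝓞 F') in cofinite, ρ₂.IsUnramifiedAt v) ∧
              (∀ v : HeightOneSpectrum (𝓞 F'), (q : 𝓞 F') ∈ v.asIdeal →
                ρ₂.IsGreenbergOrdinaryOfShapeAt v ![0, 1, 1, 2, 2, 3]) ∧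
              FramedRep.IsResiduallyCongruent ρ₁ ρ₂ ∧
              ∃ (hcpt : isCompact_glFiniteIntegralLevel 6 F')
                (π : CuspidalAutomorphicRepData 6 F' hcpt),
                π.1.HasHodgeInfinityType 3 {0, 1, 1, 2, 2, 3} ∧
                ∀ᶠ v : HeightOneSpectrum (𝓞 F') in cofinite,
                  SatakeFrobCompatibleAt ιq π.1 ρ₂ v) := by
  sorry

/-- **STUB 2 — ordinary automorphy lifting in the singular weight, plain form, at the second prime**
(the route's rank-2 crux `SingularWeightLifting` with `F = F'`, as the Moret-Bailly argument consumes it for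
the fibre's `q`-adic realisation `ρ₁`): `L` totally real, `q > 13` split completely in `L`,
`ρ₁ : Γ_L → GL_6(ℚ̄_q)` irreducible, a.e. unramified, odd, `GSp_6`-valued, Greenberg-ordinary of shape
(0,1,1,2,2,3) and residually distinguished at every `w ∣ q`, `ρ̄₁|Γ_{L(ζ_q)}` absolutely irreducible, with
a seed `ρ₂` (a.e. unramified, Greenberg-ordinary of that shape at `w ∣ q`, residually congruent to `ρ₁`,
weakly automorphic of Hodge type (3; 0,1,1,2,2,3) for `ι_q`) ⟹ `ρ₁` is weakly automorphic of Hodge type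
(3; 0,1,1,2,2,3) for `ι_q`. Inside: integral higher Hida theory for the Hodge-type GSpin(2,5) fivefold at
the limit weight, Calegari–Geraghty patching in defect one, doubled-weight ordinary deformation rings — BCGP
one node over on the Dynkin diagram. Size: open problem (no higher Hida theory for a non-PEL GSpin(2,5)
host in print). Weaker, as a statement, than `SingularWeightLifting` (no transport `F ⊆ F'`).
[cite: BoxerEtAl2021, Thm. 1.1.3 and §7–8] [cite: CalegariGeraghty2017, §1] [cite: Pilloni2020, Thm. 1.1]
[cite: Thorne2012, §2] -/
theorem stub_fibreLifting :
    ∀ (L : Type) [Field L] [NumberField L] [NumberField.IsTotallyReal L] (q : ℕ) [Fact q.Prime]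
      (ιq : PadicAlgCl q ≃+* ℂ) (ρ₁ : FramedGaloisRep L (PadicAlgCl q) 6),
      (13 < q ∧ ρ₁.toGaloisRep.IsIrreducible ∧
        (∀ᶠ v : HeightOneSpectrum (𝓞 L) in cofinite, ρ₁.IsUnramifiedAt v) ∧ ρ₁.IsOdd ∧
        FramedRep.IsGSpValued ρ₁ ∧
        (∀ v : HeightOneSpectrum (𝓞 L), (q : 𝓞 L) ∈ v.asIdeal →
          ρ₁.IsGreenbergOrdinaryOfShapeAt v ![0, 1, 1, 2, 2, 3] ∧
          ρ₁.IsResiduallyDistinguishedAt v ![0, 1, 1, 2, 2, 3])) →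
      (∀ v : HeightOneSpectrum (𝓞 L), (q : 𝓞 L) ∈ v.asIdeal →
        Nat.card (𝓞 L ⧸ v.asIdeal) = q ∧ (q : 𝓞 L) ∉ v.asIdeal ^ 2) →
      FramedRep.HasAbsolutelyIrreducibleReduction (ρ₁.restrictField (CyclotomicField q L)) →
      (∃ ρ₂ : FramedGaloisRep L (PadicAlgCl q) 6,
        (∀ᶠ v : HeightOneSpectrum (𝓞 L) in cofinite, ρ₂.IsUnramifiedAt v) ∧
        (∀ v : HeightOneSpectrum (𝓞 L), (q : 𝓞 L) ∈ v.asIdeal →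
          ρ₂.IsGreenbergOrdinaryOfShapeAt v ![0, 1, 1, 2, 2, 3]) ∧
        FramedRep.IsResiduallyCongruent ρ₁ ρ₂ ∧
        ∃ (hcpt : isCompact_glFiniteIntegralLevel 6 L) (π : CuspidalAutomorphicRepData 6 L hcpt),
          π.1.HasHodgeInfinityType 3 {0, 1, 1, 2, 2, 3} ∧
          ∀ᶠ v : HeightOneSpectrum (𝓞 L) in cofinite, SatakeFrobCompatibleAt ιq π.1 ρ₂ v) →
      ∃ (hcpt : isCompact_glFiniteIntegralLevel 6 L) (π : CuspidalAutomorphicRepData 6 L hcpt),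
        π.1.HasHodgeInfinityType 3 {0, 1, 1, 2, 2, 3} ∧
        ∀ᶠ v : HeightOneSpectrum (𝓞 L) in cofinite, SatakeFrobCompatibleAt ιq π.1 ρ₁ v := by
  sorry

/-- **STUB 3 — weak automorphy passes along an `ι`-compatible pair** (Serre's compatible systems, the last
step of every potential-automorphy proof): `L` a number field, `ρ₀ : Γ_L → GL_n(ℚ̄_p)` a.e. unramified,
`ρ₁ : Γ_L → GL_n(ℚ̄_q)`, and at almost every place `v` Frobenius characteristic polynomials `P₀` of `ρ₀`
and `P₁` of `ρ₁` with `ι_p(P₀) = ι_q(P₁)` in `ℂ[X]`; if an automorphic `π` of `GL_n(𝔸_L)` is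
Satake–Frobenius compatible with `ρ₁` through `ι_q` at almost all `v` (`SatakeFrobCompatibleAt`: Satake
parameter `α`, `ρ₁` unramified, Frobenius char-poly `arithFrobPolyOfSatake ι_q q_v 1 α`), then `π` is
Satake–Frobenius compatible with `ρ₀` through `ι_p` at almost all `v`. Proof sketch: at such `v`,
`P₁ = arithFrobPolyOfSatake ι_q q_v 1 α` by uniqueness of the Frobenius char-poly (a Frobenius exists above
`v`), and `arithFrobPolyOfSatake ι q_v 1 α = (∏_{a ∈ α} (X - a⁻¹)).map ι⁻¹`
(`arithFrobPolyOfSatake_eq_map_symm`), so `ι_p(P₀) = ι_q(P₁) = ∏ (X - a⁻¹)` and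
`P₀ = arithFrobPolyOfSatake ι_p q_v 1 α`. Size M. Why it might fail: only by an API mismatch (it needs the
existence of an arithmetic Frobenius above every finite place, a named fact in `GaloisRep.lean`).
[cite: SerreAbelianLadic1968, Ch. I §2.3] [cite: BuzzardGeeLMS2014, Conj. 3.2.1 and Rem. 3.2.5] -/
theorem stub_compatibleTransfer :
    ∀ (n : ℕ) (L : Type) [Field L] [NumberField L] (p q : ℕ) [Fact p.Prime] [Fact q.Prime]
      (ιp : PadicAlgCl p ≃+* ℂ) (ιq : PadicAlgCl q ≃+* ℂ)
      (ρ₀ : FramedGaloisRep L (PadicAlgCl p) n) (ρ₁ : FramedGaloisRep L (PadicAlgCl q) n),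
      (∀ᶠ v : HeightOneSpectrum (𝓞 L) in cofinite, ρ₀.IsUnramifiedAt v) →
      (∀ᶠ v : HeightOneSpectrum (𝓞 L) in cofinite,
        ∃ (P₀ : (PadicAlgCl p)[X]) (P₁ : (PadicAlgCl q)[X]),
          ρ₀.HasFrobCharpolyAt v P₀ ∧ ρ₁.HasFrobCharpolyAt v P₁ ∧
          P₀.map (ιp : PadicAlgCl p →+* ℂ) = P₁.map (ιq : PadicAlgCl q →+* ℂ)) →
      ∀ (hcpt : isCompact_glFiniteIntegralLevel n L) (π : CuspidalAutomorphicRepData n L hcpt),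
        (∀ᶠ v : HeightOneSpectrum (𝓞 L) in cofinite, SatakeFrobCompatibleAt ιq π.1 ρ₁ v) →
        ∀ᶠ v : HeightOneSpectrum (𝓞 L) in cofinite, SatakeFrobCompatibleAt ιp π.1 ρ₀ v := by
  sorry

/-! ## 2. The stub statements as named `Prop`s (literally their types) -/

namespace _Goal

/-- The statement of `stub_moretBaillyPair`, as a named `Prop` (literally its type). [folklore] -/
def stub_moretBaillyPair : Prop :=
  type_of% @Summit.Langlands.Langlands.Cruxes.MoretBaillySeed.Birth.stub_moretBaillyPair

/-- The statement of `stub_fibreLifting`, as a named `Prop` (literally its type). [folklore] -/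
def stub_fibreLifting : Prop :=
  type_of% @Summit.Langlands.Langlands.Cruxes.MoretBaillySeed.Birth.stub_fibreLifting

/-- The statement of `stub_compatibleTransfer`, as a named `Prop` (literally its type). [folklore] -/
def stub_compatibleTransfer : Prop :=
  type_of% @Summit.Langlands.Langlands.Cruxes.MoretBaillySeed.Birth.stub_compatibleTransfer

end _Goal

/-! ## 3. The composition (kernel-checked, no `sorry`): PAIR → LIFTING at `q` → TRANSFER → the crux by name -/

/-- **`MoretBaillySeed` from the three stubs.** Given `ρ` over `F` with the hypotheses of the crux:
`stub_moretBaillyPair` yields `F'` (finite Galois, totally real, `p` split completely, both irreducibility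
clauses), the `p`-adic `ρ₀` (a.e. unramified, Greenberg-ordinary at `w ∣ p`, `≡ ρ|F' mod 𝔪`) and an
`ι`-compatible `q`-adic partner `ρ₁` carrying the lifting antecedent at `q`; `stub_fibreLifting` makes `ρ₁`
weakly automorphic of Hodge type (3; 0,1,1,2,2,3) for `ι_q` (some cuspidal `π` on `GL_6(𝔸_{F'})`);
`stub_compatibleTransfer` moves the Satake–Frobenius matching from `(ρ₁, ι_q)` to `(ρ₀, ι)`. So `ρ₀` is the
seed the crux asks for. The hypotheses are, by name, the statements of the three stubs; the conclusion is the
route decl `Summit.Langlands.Langlands.Theses.GSpinCensusRung.MoretBaillySeed`. [folklore] -/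
theorem MoretBaillySeed_of (hA : _Goal.stub_moretBaillyPair) (hB : _Goal.stub_fibreLifting)
    (hC : _Goal.stub_compatibleTransfer) :
    Summit.Langlands.Langlands.Theses.GSpinCensusRung.MoretBaillySeed := by
  -- the stub statements, as the Π-types they literally are
  have hPair : type_of% @stub_moretBaillyPair := hA
  have hLift : type_of% @stub_fibreLifting := hB
  have hTrans : type_of% @stub_compatibleTransfer := hC
  intro F _ _ _ p _ ι ρ hcore hsplit hres
  obtain ⟨F', iF, iN, iA, iG, hTR, hirr, hsplit', hres', ρ₀, hur₀, hord₀, hcong, q, iq, ιq, ρ₁,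
    hcompat, hcore₁, hsplitq, hres₁, hseed₁⟩ := hPair F p ι ρ hcore hsplit hres
  haveI := hTR
  haveI := iq
  -- the fibre's `q`-adic realisation is weakly automorphic over `F'` (lifting at the second prime) …
  obtain ⟨hcpt, π, hHodge, hSat⟩ := hLift F' q ιq ρ₁ hcore₁ hsplitq hres₁ hseed₁
  -- … and the matching transfers to the `p`-adic member `ρ₀` of the compatible pair
  have hSat₀ := hTrans 6 F' p q ι ιq ρ₀ ρ₁ hur₀ hcompat hcpt π hSat
  exact ⟨F', iF, iN, iA, iG, hTR, hirr, hsplit', hres', ρ₀, hur₀, hord₀, hcong, hcpt, π, hHodge, hSat₀⟩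

/-- By-name sanity check (an `example`, not a declaration of the file): the three stubs feed the
composition as they stand. -/
example : Summit.Langlands.Langlands.Theses.GSpinCensusRung.MoretBaillySeed :=
  MoretBaillySeed_of stub_moretBaillyPair stub_fibreLifting stub_compatibleTransfer

end Summit.Langlands.Langlands.Cruxes.MoretBaillySeed.Birth

end
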